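import Mathlib.FieldTheory.IsAlgClosed.Basic
import Mathlib.Algebra.Polynomial.EraseLead
import Mathlib.Algebra.Polynomial.Inductions
import HarnessLib

/-!
# The fibre lemma (pseudo-division over a two-step polynomial tower)

Zilber's Exponential-Algebraic Closedness, case ladder (host summit Schanuel, cell `pub-schanuel`,
seat 2, gen 5).  Elementary commutative algebra behind the FIBRATION PRINCIPLE of
`ZilberEacFibration.lean` ("a 3-fold fibred in curves over a surface with Zariski-dense
exponential points meets `Γ_exp`").

Setting.  `A` a domain (later `A = ℂ[x', y']`), `K` a field (later the function field of the
variety) and the **generic evaluation** of the tower `A[U][V]` at a generic point: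
`ev : A →+* K`, `U ↦ u`, `V ↦ v` (`eval₂RingHom ev u : A[U] →+* K` and
`eval₂RingHom (eval₂RingHom ev u) v : A[U][V] →+* K`;
their kernels are the prime ideals `P₁ ⊆ P₂ ⊆ P₃` of the projections of the variety).

* (T) `u` is TRANSCENDENTAL over `A` modulo the kernel: every `h ∈ A[U]` killed by the generic
  evaluation has all its coefficients killed (`Z(P₂) = Z(P₁) × 𝔸¹`).
* (A) `v` is ALGEBRAIC: some `G ∈ A[U][V]` is killed while one of its `V`-coefficients is not.

**Theorem** (`fibre_core`).  Under (T), (A) and `v ≠ 0` there is `c ∈ A`, not killed by `ev`, such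
that for every specialisation `ψ : A →+* F` into an algebraically closed field factoring through the
kernel of `ev` (a point of `Z(P₁)`) with `ψ c ≠ 0`, all but finitely many `u₀ ∈ F` admit
`v₀ ∈ F`, `v₀ ≠ 0`, with `H(ψ, u₀, v₀) = 0` for EVERY `H ∈ A[U][V]` killed by the generic evaluation
— a point of the variety in the fibre over `(ψ, u₀)`.

Proof: pseudo-division by a killed `G` of minimal `V`-degree (its leading and constant
coefficients are not killed: `eraseLead`, `divX`), induction on `deg_V H`, roots of `G(ψ,u₀,·)`.
Honest framing: folklore algebra (a hands-on "lying over" for one algebraic variable); nothing about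
`EC(3,2)` (OPEN) or Schanuel's conjecture is asserted here.
-/

noncomputable section

open Polynomial

set_option linter.dupNamespace false

namespace Summit.Schanuel.Schanuel.Theorems

variable {A K : Type*} [CommRing A] [Field K]

-- Evaluations of the tower: `eval₂RingHom ev u : A[U] →+* K` ("`towerEval₂`") and
-- `eval₂RingHom (eval₂RingHom ev u) v : A[U][V] →+* K` ("`towerEval₃`").

/-- `towerEval₃` on constants `C h` is `towerEval₂ h`. [folklore] -/
theorem towerEval₃_C (ev : A →+* K) (u v : K) (h : Polynomial A) :
    (eval₂RingHom (eval₂RingHom ev u) v) (C h) = (eval₂RingHom ev u) h := eval₂_C _ _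
/-- `towerEval₃` on the variable `V` is `v`. [folklore] -/
theorem towerEval₃_X (ev : A →+* K) (u v : K) :
    (eval₂RingHom (eval₂RingHom ev u) v) (X : Polynomial (Polynomial A)) = v := eval₂_X _ _
/-- `towerEval₂` on constants. [folklore] -/
theorem towerEval₂_C (ev : A →+* K) (u : K) (a : A) :
    (eval₂RingHom ev u) (C a) = ev a := eval₂_C _ _

/-- If every coefficient of `h` is killed by `ev` then `h` is killed by `(eval₂RingHom ev u)`.
[folklore] -/
theorem towerEval₂_eq_zero_of_coeff (ev : A →+* K) (u : K) {h : Polynomial A}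
    (hc : ∀ i, ev (h.coeff i) = 0) : (eval₂RingHom ev u) h = 0 := by
  rw [coe_eval₂RingHom, eval₂_eq_sum_range]
  exact Finset.sum_eq_zero fun i _ => by rw [hc i, zero_mul]

/-- Contrapositive: a polynomial not killed by `towerEval₂` has a coefficient not killed by `ev`.
[folklore] -/
theorem exists_coeff_ne_zero_of_towerEval₂_ne_zero (ev : A →+* K) (u : K) {h : Polynomial A}
    (hh : (eval₂RingHom ev u) h ≠ 0) : ∃ i, ev (h.coeff i) ≠ 0 := by
  by_contra hcon
  push Not at hcon
  exact hh (towerEval₂_eq_zero_of_coeff ev u hcon)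

/-! ## The minimal relation -/

section Minimal

variable {ev : A →+* K} {u v : K}

/-- A relation of MINIMAL `V`-degree exists as soon as some relation exists (hypothesis (A)).
[folklore] -/
theorem exists_minimal_relation
    (hA : ∃ G : Polynomial (Polynomial A), (eval₂RingHom (eval₂RingHom ev u) v) G = 0 ∧
      ∃ i, (eval₂RingHom ev u) (G.coeff i) ≠ 0) :
    ∃ G : Polynomial (Polynomial A), (eval₂RingHom (eval₂RingHom ev u) v) G = 0 ∧
      (∃ i, (eval₂RingHom ev u) (G.coeff i) ≠ 0) ∧
      ∀ H : Polynomial (Polynomial A), (eval₂RingHom (eval₂RingHom ev u) v) H = 0 →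
        (∃ i, (eval₂RingHom ev u) (H.coeff i) ≠ 0) → G.natDegree ≤ H.natDegree := by
  classical
  -- the `V`-degrees of relations (killed polynomials with a coefficient that is not killed)
  have hex : ∃ n, ∃ G : Polynomial (Polynomial A), (eval₂RingHom (eval₂RingHom ev u) v) G = 0 ∧
      G.natDegree = n ∧
      ∃ i, (eval₂RingHom ev u) (G.coeff i) ≠ 0 := by
    obtain ⟨G, hG, hi⟩ := hA
    exact ⟨G.natDegree, G, hG, rfl, hi⟩
  obtain ⟨G, hG, hdeg, hi⟩ := Nat.find_spec hex
  refine ⟨G, hG, hi, fun H hH hHi => ?_⟩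
  rw [hdeg]
  exact Nat.find_min' hex ⟨H, hH, rfl, hHi⟩

/-- A minimal relation has positive `V`-degree. [folklore] -/
theorem natDegree_pos_of_minimal {G : Polynomial (Polynomial A)}
    (hG : (eval₂RingHom (eval₂RingHom ev u) v) G = 0)
    (hi : ∃ i, (eval₂RingHom ev u) (G.coeff i) ≠ 0) : 0 < G.natDegree := by
  by_contra h0
  push Not at h0
  have h0' : G.natDegree = 0 := Nat.le_zero.mp h0
  obtain ⟨i, hi⟩ := hi
  have hGC : G = C (G.coeff 0) := Polynomial.eq_C_of_natDegree_eq_zero h0'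
  rcases Nat.eq_zero_or_pos i with rfl | hipos
  · apply hi
    have := hG
    rw [hGC, towerEval₃_C] at this
    simpa using this
  · apply hi
    have : G.coeff i = 0 := by
      rw [hGC, coeff_C, if_neg (Nat.pos_iff_ne_zero.mp hipos)]
    rw [this, map_zero]

/-- **The leading coefficient of a minimal relation is not killed.** [folklore] -/
theorem towerEval₂_leadingCoeff_ne_zero {G : Polynomial (Polynomial A)}
    (hG : (eval₂RingHom (eval₂RingHom ev u) v) G = 0)
    (hi : ∃ i, (eval₂RingHom ev u) (G.coeff i) ≠ 0)
    (hmin : ∀ H : Polynomial (Polynomial A), (eval₂RingHom (eval₂RingHom ev u) v) H = 0 →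
        (∃ i, (eval₂RingHom ev u) (H.coeff i) ≠ 0) → G.natDegree ≤ H.natDegree) :
    (eval₂RingHom ev u) G.leadingCoeff ≠ 0 := by
  intro hlc
  obtain ⟨i, hi⟩ := hi
  have hine : i ≠ G.natDegree := by
    rintro rfl
    exact hi hlc
  have hcoeffi : G.coeff i ≠ 0 := by
    intro h; apply hi; rw [h, map_zero]
  -- the erased polynomial is a relation of smaller degree
  set G' := G.eraseLead with hG'
  have hG'i : G'.coeff i = G.coeff i := Polynomial.eraseLead_coeff_of_ne i hine
  have hG'ne : G' ≠ 0 := by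
    intro h
    apply hcoeffi
    rw [← hG'i, h, coeff_zero]
  have hG'rel : (eval₂RingHom (eval₂RingHom ev u) v) G' = 0 := by
    have hsplit := Polynomial.eraseLead_add_monomial_natDegree_leadingCoeff G
    have := congrArg ((eval₂RingHom (eval₂RingHom ev u) v)) hsplit
    rw [map_add, hG, ← C_mul_X_pow_eq_monomial, map_mul, map_pow, towerEval₃_C, towerEval₃_X,
      hlc, zero_mul, add_zero] at this
    exact this
  have hG'lt : G'.natDegree < G.natDegree := by
    rcases Polynomial.eraseLead_natDegree_lt_or_eraseLead_eq_zero G with h | h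
    · exact h
    · exact absurd h hG'ne
  have hle := hmin G' hG'rel ⟨i, by rw [hG'i]; exact hi⟩
  omega

/-- **The constant coefficient of a minimal relation is not killed**, provided `v ≠ 0`.
[folklore] -/
theorem towerEval₂_coeff_zero_ne_zero (hv : v ≠ 0) {G : Polynomial (Polynomial A)}
    (hG : (eval₂RingHom (eval₂RingHom ev u) v) G = 0)
    (hi : ∃ i, (eval₂RingHom ev u) (G.coeff i) ≠ 0)
    (hmin : ∀ H : Polynomial (Polynomial A), (eval₂RingHom (eval₂RingHom ev u) v) H = 0 →
        (∃ i, (eval₂RingHom ev u) (H.coeff i) ≠ 0) → G.natDegree ≤ H.natDegree) :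
    (eval₂RingHom ev u) (G.coeff 0) ≠ 0 := by
  intro h0
  have hpos : 0 < G.natDegree := natDegree_pos_of_minimal hG hi
  have hlc : (eval₂RingHom ev u) G.leadingCoeff ≠ 0 := towerEval₂_leadingCoeff_ne_zero hG hi hmin
  -- `G = V · divX G + C (G₀)`, so `divX G` is a relation of degree `natDegree G - 1`
  set G' := G.divX with hG'
  have hG'rel : (eval₂RingHom (eval₂RingHom ev u) v) G' = 0 := by
    have hsplit := Polynomial.X_mul_divX_add G
    have := congrArg ((eval₂RingHom (eval₂RingHom ev u) v)) hsplit
    rw [map_add, map_mul, towerEval₃_X, towerEval₃_C, h0, add_zero, hG] at this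
    exact (mul_eq_zero.mp this).resolve_left hv
  have hG'deg : G'.natDegree = G.natDegree - 1 := Polynomial.natDegree_divX_eq_natDegree_tsub_one
  have hG'coeff : (eval₂RingHom ev u) (G'.coeff (G.natDegree - 1)) ≠ 0 := by
    rw [hG', Polynomial.coeff_divX, Nat.sub_add_cancel hpos]
    exact hlc
  have hle := hmin G' hG'rel ⟨G.natDegree - 1, hG'coeff⟩
  omega

end Minimal

/-! ## Specialisation and the induction -/

section Specialise

variable {F : Type*} [Field F]
variable {ev : A →+* K} {u v : K}

/-- Under (T), a specialisation `ψ : A →+* F` through the kernel of `ev`, extended by `U ↦ u₀`,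
kills every `h ∈ A[U]` killed by the generic evaluation (`Z(P₂) = Z(P₁) × 𝔸¹`). [folklore] -/
theorem eval₂_eq_zero_of_towerEval₂_eq_zero
    (hT : ∀ h : Polynomial A, (eval₂RingHom ev u) h = 0 → ∀ i, ev (h.coeff i) = 0)
    {ψ : A →+* F} (hψ : ∀ a, ev a = 0 → ψ a = 0) (u₀ : F)
    {h : Polynomial A} (hh : (eval₂RingHom ev u) h = 0) : h.eval₂ ψ u₀ = 0 := by
  rw [eval₂_eq_sum_range]
  exact Finset.sum_eq_zero fun i _ => by rw [hψ _ (hT h hh i), zero_mul]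

/-- **The induction.**  If `χ : A[U] →+* F` kills everything killed by `(eval₂RingHom ev u)`, and
`χ (lc G) ≠ 0` for a minimal relation `G`, then at every root `v₀` of `G^χ` every `H ∈ A[U][V]`
killed by the generic evaluation satisfies `H^χ(v₀) = 0`. [folklore] -/
theorem eval_map_eq_zero_of_root [IsDomain A] {G : Polynomial (Polynomial A)}
    (hG : (eval₂RingHom (eval₂RingHom ev u) v) G = 0)
    (hmin : ∀ H : Polynomial (Polynomial A), (eval₂RingHom (eval₂RingHom ev u) v) H = 0 →
        (∃ i, (eval₂RingHom ev u) (H.coeff i) ≠ 0) → G.natDegree ≤ H.natDegree)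
    (χ : Polynomial A →+* F) (hχ : ∀ h : Polynomial A, (eval₂RingHom ev u) h = 0 → χ h = 0)
    (hχg : χ G.leadingCoeff ≠ 0) {v₀ : F} (hv₀ : (G.map χ).eval v₀ = 0)
    (H : Polynomial (Polynomial A)) (hH : (eval₂RingHom (eval₂RingHom ev u) v) H = 0) :
    (H.map χ).eval v₀ = 0 := by
  -- strong induction on the `V`-degree of `H`
  suffices hmain : ∀ n (H : Polynomial (Polynomial A)), H.natDegree < n →
      (eval₂RingHom (eval₂RingHom ev u) v) H = 0 → (H.map χ).eval v₀ = 0 from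
    hmain (H.natDegree + 1) H (Nat.lt_succ_self _) hH
  intro n
  induction n with
  | zero => intro H hlt; exact absurd hlt (Nat.not_lt_zero _)
  | succ n ih =>
    intro H hlt hH0
    by_cases hsmall : H.natDegree < G.natDegree
    · -- every coefficient of `H` is killed, hence dies under `χ`: `H^χ = 0`
      have hall : ∀ i, (eval₂RingHom ev u) (H.coeff i) = 0 := by
        by_contra hcon
        push Not at hcon
        have := hmin H hH0 hcon
        omega
      have hmap : H.map χ = 0 := by
        ext i
        rw [coeff_map, hχ _ (hall i), coeff_zero]
      rw [hmap, eval_zero]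
    · push Not at hsmall
      have hg0 : G.leadingCoeff ≠ 0 := by
        intro h; apply hχg; rw [h, map_zero]
      have hGne : G ≠ 0 := fun h => hg0 (by rw [h, leadingCoeff_zero])
      have hGpos : 0 < G.natDegree := by
        -- a minimal relation of degree `0` would be the nonzero constant `lc G`, killed: absurd
        by_contra h0
        push Not at h0
        have h0' : G.natDegree = 0 := Nat.le_zero.mp h0
        have hGC : G = C (G.coeff 0) := Polynomial.eq_C_of_natDegree_eq_zero h0'
        have hk : (eval₂RingHom ev u) (G.coeff 0) = 0 := by
          have := hG
          rw [hGC, towerEval₃_C] at this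
          exact this
        have := hχ _ hk
        rw [Polynomial.leadingCoeff, h0'] at hχg
        exact hχg this
      have hHne : H ≠ 0 := by
        intro h
        rw [h, natDegree_zero] at hsmall
        omega
      -- one pseudo-division step
      set m := H.natDegree with hm
      set H₁ : Polynomial (Polynomial A) :=
        C G.leadingCoeff * H - C H.leadingCoeff * X ^ (m - G.natDegree) * G with hH₁
      have hH₁rel : (eval₂RingHom (eval₂RingHom ev u) v) H₁ = 0 := by
        rw [hH₁, map_sub, map_mul, map_mul, map_mul, hH0, hG, mul_zero, mul_zero, sub_zero]
      have hH₁deg : H₁.natDegree < m := by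
        by_cases hz : H₁ = 0
        · rw [hz, natDegree_zero]; omega
        · have hp0 : C G.leadingCoeff * H ≠ 0 := mul_ne_zero (by rwa [Ne, C_eq_zero]) hHne
          have hdegp : (C G.leadingCoeff * H).degree = (m : WithBot ℕ) := by
            rw [degree_C_mul hg0, degree_eq_natDegree hHne]
          have hlcH : H.leadingCoeff ≠ 0 := leadingCoeff_ne_zero.mpr hHne
          have hdegq : (C H.leadingCoeff * X ^ (m - G.natDegree) * G).degree = (m : WithBot ℕ) := by
            rw [mul_assoc, degree_C_mul hlcH, degree_mul, degree_X_pow, degree_eq_natDegree hGne,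
              ← Nat.cast_add, Nat.sub_add_cancel hsmall]
          have hlc : (C G.leadingCoeff * H).leadingCoeff =
              (C H.leadingCoeff * X ^ (m - G.natDegree) * G).leadingCoeff := by
            rw [leadingCoeff_mul, leadingCoeff_C, leadingCoeff_mul, leadingCoeff_mul,
              leadingCoeff_C, leadingCoeff_X_pow, mul_one, mul_comm]
          have hlt' : H₁.degree < (C G.leadingCoeff * H).degree := by
            rw [hH₁]
            exact degree_sub_lt (hdegp.trans hdegq.symm) hp0 hlc
          have := natDegree_lt_natDegree hz hlt'
          rwa [natDegree_C_mul hg0] at this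
      have hIH : (H₁.map χ).eval v₀ = 0 := ih H₁ (by omega) hH₁rel
      -- expand the pseudo-division identity under `χ` at `v₀`
      have hexp : (H₁.map χ).eval v₀ =
          χ G.leadingCoeff * (H.map χ).eval v₀ -
            χ H.leadingCoeff * v₀ ^ (m - G.natDegree) * (G.map χ).eval v₀ := by
        rw [hH₁]
        simp only [Polynomial.map_sub, Polynomial.map_mul, Polynomial.map_pow, map_C, map_X,
          eval_sub, eval_mul, eval_C, eval_pow, eval_X]
      rw [hexp, hv₀, mul_zero, sub_zero] at hIH
      exact (mul_eq_zero.mp hIH).resolve_left hχg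

end Specialise

/-! ## The fibre lemma -/

section Core

variable [IsDomain A] {F : Type*} [Field F] [IsAlgClosed F]
variable {ev : A →+* K} {u v : K}

/-- One fibre point: for a minimal relation `G`, a specialisation `ψ` through the kernel of `ev`
and `u₀` with `lc(G)(ψ, u₀) ≠ 0`, some root `v₀` of `G(ψ, u₀, ·)` kills every `H` killed by the
generic evaluation; `v₀ ≠ 0` as soon as `G₀(ψ, u₀) ≠ 0`. [folklore] -/
theorem exists_fibre_point {G : Polynomial (Polynomial A)}
    (hG : (eval₂RingHom (eval₂RingHom ev u) v) G = 0)
    (hi : ∃ i, (eval₂RingHom ev u) (G.coeff i) ≠ 0)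
    (hmin : ∀ H : Polynomial (Polynomial A), (eval₂RingHom (eval₂RingHom ev u) v) H = 0 →
        (∃ i, (eval₂RingHom ev u) (H.coeff i) ≠ 0) → G.natDegree ≤ H.natDegree)
    (hT : ∀ h : Polynomial A, (eval₂RingHom ev u) h = 0 → ∀ i, ev (h.coeff i) = 0)
    {ψ : A →+* F} (hψ : ∀ a, ev a = 0 → ψ a = 0) {u₀ : F}
    (hu₀ : (G.leadingCoeff.map ψ).eval u₀ ≠ 0) :
    ∃ v₀ : F, (((G.coeff 0).map ψ).eval u₀ ≠ 0 → v₀ ≠ 0) ∧ ∀ H : Polynomial (Polynomial A),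
      (eval₂RingHom (eval₂RingHom ev u) v) H = 0 →
        (H.map (Polynomial.eval₂RingHom ψ u₀)).eval v₀ = 0 := by
  set χ : Polynomial A →+* F := Polynomial.eval₂RingHom ψ u₀ with hχdef
  have hχ : ∀ h : Polynomial A, (eval₂RingHom ev u) h = 0 → χ h = 0 := fun h hh =>
    eval₂_eq_zero_of_towerEval₂_eq_zero hT hψ u₀ hh
  have hχg : χ G.leadingCoeff ≠ 0 := by rwa [eval_map] at hu₀
  -- the specialised relation `G^χ` has degree `natDegree G ≥ 1`: pick a root
  have hdeg : (G.map χ).natDegree = G.natDegree := natDegree_map_of_leadingCoeff_ne_zero χ hχg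
  have hpos : 0 < G.natDegree := natDegree_pos_of_minimal hG hi
  have hdeg' : (G.map χ).degree ≠ 0 := by
    intro h
    have h1 := Polynomial.natDegree_eq_of_degree_eq_some (n := 0) (by simpa using h)
    omega
  obtain ⟨v₀, hv₀⟩ := IsAlgClosed.exists_root (G.map χ) hdeg'
  refine ⟨v₀, fun h0 => ?_, fun H hH => eval_map_eq_zero_of_root hG hmin χ hχ hχg hv₀ H hH⟩
  rintro rfl
  apply h0
  rw [IsRoot.def, ← coeff_zero_eq_eval_zero, coeff_map] at hv₀
  rwa [eval_map]

/-- **Fibre lemma** (hands-on lying-over for one algebraic variable).  Under (T) (`u`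
transcendental modulo the kernel), (A) (`v` algebraic) and `v ≠ 0`: there is `c ∈ A` with
`ev c ≠ 0` such that for every specialisation `ψ : A →+* F` through the kernel of `ev` with
`ψ c ≠ 0`, all but finitely many `u₀ ∈ F` admit `v₀ ≠ 0` with `H(ψ, u₀, v₀) = 0` for every `H`
killed by the generic evaluation. [folklore] -/
theorem fibre_core
    (hT : ∀ h : Polynomial A, (eval₂RingHom ev u) h = 0 → ∀ i, ev (h.coeff i) = 0)
    (hA : ∃ G : Polynomial (Polynomial A), (eval₂RingHom (eval₂RingHom ev u) v) G = 0 ∧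
      ∃ i, (eval₂RingHom ev u) (G.coeff i) ≠ 0)
    (hv : v ≠ 0) :
    ∃ c : A, ev c ≠ 0 ∧ ∀ ψ : A →+* F, (∀ a, ev a = 0 → ψ a = 0) → ψ c ≠ 0 →
      Set.Finite {u₀ : F | ¬ ∃ v₀ : F, v₀ ≠ 0 ∧ ∀ H : Polynomial (Polynomial A),
        (eval₂RingHom (eval₂RingHom ev u) v) H = 0 →
          (H.map (Polynomial.eval₂RingHom ψ u₀)).eval v₀ = 0} := by
  classical
  obtain ⟨G, hG, hi, hmin⟩ := exists_minimal_relation hA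
  have hlc : (eval₂RingHom ev u) G.leadingCoeff ≠ 0 := towerEval₂_leadingCoeff_ne_zero hG hi hmin
  have hc0 : (eval₂RingHom ev u) (G.coeff 0) ≠ 0 := towerEval₂_coeff_zero_ne_zero hv hG hi hmin
  obtain ⟨i₁, hi₁⟩ := exists_coeff_ne_zero_of_towerEval₂_ne_zero ev u hlc
  obtain ⟨i₀, hi₀⟩ := exists_coeff_ne_zero_of_towerEval₂_ne_zero ev u hc0
  refine ⟨G.leadingCoeff.coeff i₁ * (G.coeff 0).coeff i₀, ?_, fun ψ hψ hψc => ?_⟩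
  · rw [map_mul]; exact mul_ne_zero hi₁ hi₀
  rw [map_mul] at hψc
  -- the two specialised one-variable polynomials are nonzero, so have finitely many roots
  have hg₁ : G.leadingCoeff.map ψ ≠ 0 := fun h => left_ne_zero_of_mul hψc (by
    simpa only [coeff_map, coeff_zero] using congrArg (fun p => p.coeff i₁) h)
  have hg₀ : (G.coeff 0).map ψ ≠ 0 := fun h => right_ne_zero_of_mul hψc (by
    simpa only [coeff_map, coeff_zero] using congrArg (fun p => p.coeff i₀) h)
  refine ((Polynomial.finite_setOf_isRoot hg₁).union (Polynomial.finite_setOf_isRoot hg₀)).subset ?_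
  intro u₀ hu₀
  by_contra hgood
  apply hu₀
  simp only [Set.mem_union, Set.mem_setOf_eq, IsRoot.def] at hgood
  push Not at hgood
  obtain ⟨v₀, hv₀ne, hv₀⟩ := exists_fibre_point hG hi hmin hT hψ hgood.1
  exact ⟨v₀, hv₀ne hgood.2, hv₀⟩

/-- **Fibre lemma, plain form** (no `v ≠ 0`, no `v₀ ≠ 0`). [folklore] -/
theorem fibre_core'
    (hT : ∀ h : Polynomial A, (eval₂RingHom ev u) h = 0 → ∀ i, ev (h.coeff i) = 0)
    (hA : ∃ G : Polynomial (Polynomial A), (eval₂RingHom (eval₂RingHom ev u) v) G = 0 ∧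
      ∃ i, (eval₂RingHom ev u) (G.coeff i) ≠ 0) :
    ∃ c : A, ev c ≠ 0 ∧ ∀ ψ : A →+* F, (∀ a, ev a = 0 → ψ a = 0) → ψ c ≠ 0 →
      Set.Finite {u₀ : F | ¬ ∃ v₀ : F, ∀ H : Polynomial (Polynomial A),
        (eval₂RingHom (eval₂RingHom ev u) v) H = 0 →
          (H.map (Polynomial.eval₂RingHom ψ u₀)).eval v₀ = 0} := by
  classical
  obtain ⟨G, hG, hi, hmin⟩ := exists_minimal_relation hA
  have hlc : (eval₂RingHom ev u) G.leadingCoeff ≠ 0 := towerEval₂_leadingCoeff_ne_zero hG hi hmin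
  obtain ⟨i₁, hi₁⟩ := exists_coeff_ne_zero_of_towerEval₂_ne_zero ev u hlc
  refine ⟨G.leadingCoeff.coeff i₁, hi₁, fun ψ hψ hψ₁ => ?_⟩
  have hg₁ : G.leadingCoeff.map ψ ≠ 0 := fun h => hψ₁ (by
    simpa only [coeff_map, coeff_zero] using congrArg (fun p => p.coeff i₁) h)
  refine (Polynomial.finite_setOf_isRoot hg₁).subset ?_
  intro u₀ hu₀
  by_contra hgood
  apply hu₀
  simp only [Set.mem_setOf_eq, IsRoot.def] at hgood
  obtain ⟨v₀, -, hv₀⟩ := exists_fibre_point hG hi hmin hT hψ hgood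
  exact ⟨v₀, hv₀⟩

end Core

end Summit.Schanuel.Schanuel.Theorems
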